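import Summits.NavierStokesRegularity.NavierStokesRegularity.Theses.RellichScar
import Literature.Analysis.FluidPDE.PineauVicolRSS

/-!
# `SymmetricScarExists` (crux stmt-NavierStokesRegularity-11718, route RellichScar): the omitted
# rotated-self-similar symmetry class — negative-side support of the crux disprover (cdisprove seat)

The crux asserts: if a singular apex Type-I profile exists, then one exists whose SCAR (trace at the
singular time off the origin, rendered by ess-sup smallness of differences on `(−δ,0) × K`) is
(−1)-HOMOGENEOUS or AXISYMMETRIC about the `x₃`-axis.  Pineau–Vicol 2026 (arXiv:2607.09619,
pp. 3–7; tree `PineauVicolRSS.lean`): composing the scaling and rotation symmetries gives Perelman's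
ROTATED SELF-SIMILAR (RSS) class `u(x,t) = λ R(2α log λ) u(λ R(−2α log λ) x, λ² t)` (∀ `λ > 0`),
whose Type-I members are the subject of the OPEN Conjecture 1.1 (= Tsai GSM 192 Conj. 8.9 =
Bradshaw–Tsai OP 5.2; Thm 1.4 settles `|α| < α₁(C)` and `|α| > α₂(C)` only).  Proved here,
`sorry`-free:

* `IsSpiralRSS α u` — RSS in group form: rescaling by `e^{−θ/(2α)}` = rotation-conjugation by `θ`
  on `t < 0`; `isSpiralRSS_pvAnsatz` — the tree's ansatz field `pvAnsatz α U` ((1.7)) has it;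
  `IsSpiralRSS.dss` — such a field is DSS with factor `e^{π/α}` (Remark 1.5; `≈ 23` for `α ≈ 1`,
  outside the near-`1` windows of Chae–Wolf 2017 / P–V Thm 1.7);
* `homScar_iff_axiScar_of_isSpiralRSS` — on RSS fields the crux's two alternatives COINCIDE;
  `spiralScar_of_isSpiralRSS` — RSS fields have SPIRAL scars (invariance under
  `λ ↦ R_{2α log λ} ∘ D_λ`), the third kind of one-parameter subgroup of `ℝ₊ × SO(2)`, which the
  crux's dichotomy omits (informally: the far-field balance `α(JA − ∂_φA) + ½∂_τA = 0` of the profile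
  equation (1.8a) makes the pattern a log-spiral `R_{−2ατ}A₀(R_{2ατ}ŷ)`, generically neither
  homogeneous nor axisymmetric);
* `not_symmetricScarExists_of_spiral_world` — CONDITIONAL REFUTATION: if a singular apex profile
  exists and every singular apex profile is `α`-RSS (one fixed `α ≠ 0`) with a non-axisymmetric scar
  (the symmetry orbit of a single `α ≈ 1` RSS Type-I profile with non-equivariant pattern — a world no
  Liouville theorem in print excludes, and in which `ScarRigidity` is consistent), the crux is FALSE;
* `SymmetricScarExistsSpiral` — the repaired statement (add `∃ α, SpiralScar α u`), implied by the
  crux (`symmetricScarExistsSpiral_of_symmetricScarExists`) and TRUE in the spiral world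
  (`symmetricScarExistsSpiral_of_spiral_world`); its missing third Fatal support is, under
  `ScarRigidity`, exactly Conjecture 1.1 (tree fact `pineauVicol2026_rss_liouville` gives the ends).

Readback certificate `symmetricScarExists_iff_homScar_or_axiScar` (`Iff.rfl`).  The predicates
`SameScar`, `conjZ`, `HomScar`, `AxiScar`, `SpiralScar`, `IsSpiralRSS` are abbreviations of
sub-formulas of the route file (no new mathematics is posited).

## References

* B. Pineau, V. Vicol, arXiv:2607.09619 (2026): §1.2 (1.6)–(1.10), Conjecture 1.1, Remarks 1.2–1.5,
  Theorem 1.4 (pp. 3–5), §1.4 Theorem 1.7 (p. 7). [PineauVicol2026]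
* T.-P. Tsai, GSM 192 (2018), Conj. 8.9; Z. Bradshaw, T.-P. Tsai, Comm. PDE 42 (2017), OP 5.2.
* G. Koch, N. Nadirashvili, G. Seregin, V. Šverák, Acta Math. 203 (2009), §1. [KNSS2009]
-/

noncomputable section

open MeasureTheory Set Function Filter Topology TopologicalSpace Metric
open scoped NNReal ENNReal

namespace Summit.NavierStokesRegularity.NavierStokesRegularity.Theorems.SymmetricScarExists.Negative

open Literature.Analysis.FluidPDE
open Summit.NavierStokesRegularity.NavierStokesRegularity.Theses.RellichScar

section Spiral

variable {u v w : ℝ → (EuclideanSpace ℝ (Fin 3)) → (EuclideanSpace ℝ (Fin 3))}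

/-- SAME SCAR (the route's inline rendering, cf. `ScarRigidity`): the essential supremum of
`‖u − v‖` over `(−δ, 0) × K` tends to `0` as `δ ↓ 0`, for every compact `K ∌ 0`. -/
def SameScar (u v : ℝ → (EuclideanSpace ℝ (Fin 3)) → (EuclideanSpace ℝ (Fin 3))) : Prop :=
  ∀ K : Set (EuclideanSpace ℝ (Fin 3)), IsCompact K → (0 : (EuclideanSpace ℝ (Fin 3))) ∉ K →
    Tendsto (fun δ : ℝ => eLpNorm (uncurry u - uncurry v) ⊤
      (volume.restrict (Ioo (-δ) 0 ×ˢ K))) (𝓝[>] 0) (𝓝 0)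

/-- Rotation-conjugation about the `x₃`-axis: `(conjZ θ u)(t, x) = R_θ u(t, R_{−θ} x)` (the form used
by the crux, `SimilarityCovariance` and `AxisymmetricApexFatal`). -/
def conjZ (θ : ℝ) (u : ℝ → (EuclideanSpace ℝ (Fin 3)) → (EuclideanSpace ℝ (Fin 3))) : ℝ → (EuclideanSpace ℝ (Fin 3)) → (EuclideanSpace ℝ (Fin 3)) := fun t x => rotZ θ (u t (rotZ (-θ) x))

/-- First disjunct of the crux's conclusion: the scar is (−1)-HOMOGENEOUS (every rescaling has the
same scar). -/
def HomScar (u : ℝ → (EuclideanSpace ℝ (Fin 3)) → (EuclideanSpace ℝ (Fin 3))) : Prop := ∀ lam : ℝ, 0 < lam → SameScar (nsRescale lam u) u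

/-- Second disjunct: the scar is AXISYMMETRIC about the `x₃`-axis (every rotation-conjugate has the
same scar). -/
def AxiScar (u : ℝ → (EuclideanSpace ℝ (Fin 3)) → (EuclideanSpace ℝ (Fin 3))) : Prop := ∀ θ : ℝ, SameScar (conjZ θ u) u

/-- The omitted third alternative: SPIRAL scar with pitch `α` — invariance of the scar under the
one-parameter subgroup `λ ↦ R_{2α log λ} ∘ D_λ` of `ℝ₊ × SO(2)` (`α = 0` is `HomScar`). -/
def SpiralScar (α : ℝ) (u : ℝ → (EuclideanSpace ℝ (Fin 3)) → (EuclideanSpace ℝ (Fin 3))) : Prop :=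
  ∀ lam : ℝ, 0 < lam → SameScar (conjZ (2 * α * Real.log lam) (nsRescale lam u)) u

/-- Readback certificate: the crux is LITERALLY "singular apex profile exists ⇒ one exists with
`HomScar ∨ AxiScar`" (definitional unfolding only). [folklore] -/
theorem symmetricScarExists_iff_homScar_or_axiScar :
    SymmetricScarExists ↔
      ∀ C : ℝ, (∃ (u : ℝ → (EuclideanSpace ℝ (Fin 3)) → (EuclideanSpace ℝ (Fin 3))) (p : ℝ → (EuclideanSpace ℝ (Fin 3)) → ℝ) (G : ℝ → (EuclideanSpace ℝ (Fin 3)) → (EuclideanSpace ℝ (Fin 3)) →L[ℝ] (EuclideanSpace ℝ (Fin 3))),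
        IsSuitableWeakSolutionOn (slab (EuclideanSpace ℝ (Fin 3)) (Iio (0 : ℝ)) isOpen_Iio) 1 0 u p ∧ HasWeakSpatialGradientOn (slab (EuclideanSpace ℝ (Fin 3)) (Iio (0 : ℝ)) isOpen_Iio) u G ∧
        typeIBound (Iio (0 : ℝ) ×ˢ univ) u p G < ⊤ ∧ HasTypeIDecay C u ∧
        IsBackwardSingularPoint u 0) →
      ∃ (C' : ℝ) (u : ℝ → (EuclideanSpace ℝ (Fin 3)) → (EuclideanSpace ℝ (Fin 3))) (p : ℝ → (EuclideanSpace ℝ (Fin 3)) → ℝ) (G : ℝ → (EuclideanSpace ℝ (Fin 3)) → (EuclideanSpace ℝ (Fin 3)) →L[ℝ] (EuclideanSpace ℝ (Fin 3))),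
        IsSuitableWeakSolutionOn (slab (EuclideanSpace ℝ (Fin 3)) (Iio (0 : ℝ)) isOpen_Iio) 1 0 u p ∧ HasWeakSpatialGradientOn (slab (EuclideanSpace ℝ (Fin 3)) (Iio (0 : ℝ)) isOpen_Iio) u G ∧
        typeIBound (Iio (0 : ℝ) ×ˢ univ) u p G < ⊤ ∧ HasTypeIDecay C' u ∧
        IsBackwardSingularPoint u 0 ∧ (HomScar u ∨ AxiScar u) :=
  Iff.rfl

/-! ### Algebra of the symmetry group `ℝ₊ × SO(2)` acting on fields -/

/-- `R_{2π} = 1`. [folklore] -/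
theorem rotZ_two_pi' (x : (EuclideanSpace ℝ (Fin 3))) : rotZ (2 * Real.pi) x = x := by
  ext i
  fin_cases i <;> simp

/-- `R_{−2π} = 1`. [folklore] -/
theorem rotZ_neg_two_pi (x : (EuclideanSpace ℝ (Fin 3))) : rotZ (-(2 * Real.pi)) x = x := by
  ext i
  fin_cases i <;> simp [Real.cos_neg, Real.sin_neg]

/-- `R_θ (a • y) = a • R_θ y`. [folklore] -/
theorem rotZ_smul' (θ a : ℝ) (y : (EuclideanSpace ℝ (Fin 3))) : rotZ θ (a • y) = a • rotZ θ y := by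
  ext i
  fin_cases i <;> simp <;> ring

/-- `conjZ 0 = id`. [folklore] -/
theorem conjZ_zero (u : ℝ → (EuclideanSpace ℝ (Fin 3)) → (EuclideanSpace ℝ (Fin 3))) : conjZ 0 u = u := by
  funext t x
  simp [conjZ]

/-- `conjZ θ ∘ conjZ φ = conjZ (θ + φ)` (the rotations about one axis form a one-parameter group).
[folklore] -/
theorem conjZ_conjZ (θ φ : ℝ) (u : ℝ → (EuclideanSpace ℝ (Fin 3)) → (EuclideanSpace ℝ (Fin 3))) : conjZ θ (conjZ φ u) = conjZ (θ + φ) u := by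
  funext t x
  simp only [conjZ]
  rw [rotZ_add, show -(θ + φ) = -φ + -θ by ring, rotZ_add]

/-- Rotation-conjugation commutes with the parabolic rescaling. [folklore] -/
theorem nsRescale_conjZ (c θ : ℝ) (u : ℝ → (EuclideanSpace ℝ (Fin 3)) → (EuclideanSpace ℝ (Fin 3))) :
    nsRescale c (conjZ θ u) = conjZ θ (nsRescale c u) := by
  funext t x
  simp only [conjZ, nsRescale_apply, rotZ_smul']

/-! ### The scar functional under modification on `t < 0` -/

/-- The scar functional only sees `t < 0`. [folklore] -/
theorem eLpNorm_scar_congr {f g h : ℝ → (EuclideanSpace ℝ (Fin 3)) → (EuclideanSpace ℝ (Fin 3))} (hfg : ∀ t < 0, ∀ x, f t x = g t x) (δ : ℝ)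
    (K : Set (EuclideanSpace ℝ (Fin 3))) :
    eLpNorm (uncurry f - uncurry h) ⊤ (volume.restrict (Ioo (-δ) 0 ×ˢ K)) =
      eLpNorm (uncurry g - uncurry h) ⊤ (volume.restrict (Ioo (-δ) 0 ×ˢ K)) := by
  refine eLpNorm_congr_ae ?_
  have h1 : ∀ᵐ z ∂(volume.restrict (Ioo (-δ) (0 : ℝ) ×ˢ (univ : Set (EuclideanSpace ℝ (Fin 3))))),
      z ∈ Ioo (-δ) (0 : ℝ) ×ˢ (univ : Set (EuclideanSpace ℝ (Fin 3))) :=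
    ae_restrict_mem (measurableSet_Ioo.prod MeasurableSet.univ)
  have h2 : ∀ᵐ z ∂(volume.restrict (Ioo (-δ) (0 : ℝ) ×ˢ K)), z ∈ Ioo (-δ) (0 : ℝ) ×ˢ (univ : Set (EuclideanSpace ℝ (Fin 3))) :=
    ae_restrict_of_ae_restrict_of_subset (prod_mono Subset.rfl (subset_univ K)) h1
  filter_upwards [h2] with z hz
  show f z.1 z.2 - h z.1 z.2 = g z.1 z.2 - h z.1 z.2
  rw [hfg z.1 hz.1.2 z.2]

/-- `SameScar` is invariant under modification of the left field on `t ≥ 0` — indeed under any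
modification agreeing on `t < 0`. [folklore] -/
theorem sameScar_congr_left {f g h : ℝ → (EuclideanSpace ℝ (Fin 3)) → (EuclideanSpace ℝ (Fin 3))} (hfg : ∀ t < 0, ∀ x, f t x = g t x) :
    SameScar f h ↔ SameScar g h := by
  unfold SameScar
  simp_rw [eLpNorm_scar_congr hfg]

/-- `SameScar` is reflexive. [folklore] -/
theorem sameScar_refl (u : ℝ → (EuclideanSpace ℝ (Fin 3)) → (EuclideanSpace ℝ (Fin 3))) : SameScar u u := by
  intro K _ _
  simp only [sub_self, eLpNorm_zero]
  exact tendsto_const_nhds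

/-! ### RSS in group form and its consequences for the crux's dichotomy -/

/-- **Rotated self-similarity (Perelman; Pineau–Vicol 2026 (1.6)–(1.7)) in group form**: for every
angle `θ`, the parabolic rescaling by `λ = e^{−θ/(2α)}` coincides on `t < 0` with the
rotation-conjugation by `θ`.  For `α ≠ 0`, as `θ` ranges over `ℝ`, `λ` ranges over all of `(0, ∞)`;
P–V's ansatz (1.7) `u = (−t)^{−1/2} R(αs) U(R(−αs) x/√(−t))`, `s = −log(−t)`, has this property
(`isSpiralRSS_pvAnsatz`). -/
def IsSpiralRSS (α : ℝ) (u : ℝ → (EuclideanSpace ℝ (Fin 3)) → (EuclideanSpace ℝ (Fin 3))) : Prop :=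
  ∀ θ : ℝ, ∀ t < 0, ∀ x : (EuclideanSpace ℝ (Fin 3)), nsRescale (Real.exp (-θ / (2 * α))) u t x = conjZ θ u t x

/-- **For an RSS field the crux's two alternatives coincide.**  If `u` is `α`-RSS with `α ≠ 0`,
then `u` has a homogeneous scar iff it has an axisymmetric scar: each rescaling of `u` IS a
rotation-conjugate and vice versa. [cite: PineauVicol2026, §1.2] -/
theorem homScar_iff_axiScar_of_isSpiralRSS {α : ℝ} (hα : α ≠ 0) (h : IsSpiralRSS α u) :
    HomScar u ↔ AxiScar u := by
  constructor
  · intro hH θ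
    exact (sameScar_congr_left (h θ)).1 (hH (Real.exp (-θ / (2 * α))) (Real.exp_pos _))
  · intro hA lam hlam
    set θ : ℝ := -(2 * α) * Real.log lam with hθ
    have hlam' : Real.exp (-θ / (2 * α)) = lam := by
      rw [hθ, show -(-(2 * α) * Real.log lam) / (2 * α) = Real.log lam by field_simp,
        Real.exp_log hlam]
    rw [← hlam']
    exact (sameScar_congr_left (h θ)).2 (hA θ)

/-- **An RSS field is discretely self-similar with factor `e^{π/α}`** (Pineau–Vicol 2026,
Remark 1.5, RSS ⊆ DSS): at `θ = −2π` the conjugation is trivial.  For `α ≈ 1` the factor is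
`e^{π} ≈ 23.1`, far outside the near-`1` windows of Chae–Wolf 2017 Thm 1.3 / P–V Thm 1.7.
[cite: PineauVicol2026, Remark 1.5 (arXiv:2607.09619 p. 5)] -/
theorem IsSpiralRSS.dss {α : ℝ} (h : IsSpiralRSS α u) :
    ∀ t < 0, ∀ x : (EuclideanSpace ℝ (Fin 3)), nsRescale (Real.exp (Real.pi / α)) u t x = u t x := by
  intro t ht x
  have key := h (-(2 * Real.pi)) t ht x
  rw [show -(-(2 * Real.pi)) / (2 * α) = Real.pi / α by ring] at key
  rw [key]
  simp only [conjZ, neg_neg, rotZ_two_pi', rotZ_neg_two_pi]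

/-- **RSS fields have spiral scars**, trivially (the spiral subgroup fixes the field itself on
`t < 0`). [cite: PineauVicol2026, §1.2] -/
theorem spiralScar_of_isSpiralRSS {α : ℝ} (hα : α ≠ 0) (h : IsSpiralRSS α u) : SpiralScar α u := by
  intro lam hlam
  set θ : ℝ := -(2 * α) * Real.log lam with hθ
  have hlam' : Real.exp (-θ / (2 * α)) = lam := by
    rw [hθ, show -(-(2 * α) * Real.log lam) / (2 * α) = Real.log lam by field_simp,
      Real.exp_log hlam]
  have hfun : ∀ t < 0, ∀ x, conjZ (2 * α * Real.log lam) (nsRescale lam u) t x = u t x := by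
    intro t ht x
    have key : ∀ y : (EuclideanSpace ℝ (Fin 3)), nsRescale lam u t y = conjZ θ u t y := by
      intro y
      have hy := h θ t ht y
      rwa [hlam'] at hy
    have e1 : conjZ (2 * α * Real.log lam) (nsRescale lam u) t x =
        conjZ (2 * α * Real.log lam) (conjZ θ u) t x := by
      simp only [conjZ, key]
    rw [e1, conjZ_conjZ, show 2 * α * Real.log lam + θ = 0 by rw [hθ]; ring, conjZ_zero]
  exact (sameScar_congr_left hfun).2 (sameScar_refl u)

/-- At pitch `0` the spiral alternative is the homogeneous one. [folklore] -/
theorem spiralScar_zero_iff : SpiralScar 0 u ↔ HomScar u := by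
  unfold SpiralScar HomScar
  simp only [mul_zero, zero_mul, conjZ_zero]

/-- **The Pineau–Vicol / Perelman ansatz field is RSS in group form** (sanity bridge to the tree's
`pvAnsatz`): for `α ≠ 0` and an `s`-independent profile, `pvAnsatz α U` satisfies `IsSpiralRSS α`
(`√(−λ²t) = λ√(−t)`, `log(−λ²t) = 2 log λ + log(−t)`, `2α log λ = −θ`). [cite: PineauVicol2026, (1.7) and Remark 1.5 (arXiv:2607.09619 pp. 3, 5)] -/
theorem isSpiralRSS_pvAnsatz {α : ℝ} (hα : α ≠ 0) (U : (EuclideanSpace ℝ (Fin 3)) → (EuclideanSpace ℝ (Fin 3))) :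
    IsSpiralRSS α (pvAnsatz α (fun y _ => U y)) := by
  intro θ t ht x
  set c : ℝ := Real.exp (-θ / (2 * α)) with hc
  have hcpos : 0 < c := Real.exp_pos _
  have hnt : 0 < -t := by linarith
  have hs : 0 < Real.sqrt (-t) := Real.sqrt_pos.2 hnt
  have hsqrt : Real.sqrt (-(c ^ 2 * t)) = c * Real.sqrt (-t) := by
    rw [show -(c ^ 2 * t) = c ^ 2 * (-t) by ring, Real.sqrt_mul (sq_nonneg c), Real.sqrt_sq hcpos.le]
  have hlog : Real.log (-(c ^ 2 * t)) = 2 * Real.log c + Real.log (-t) := by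
    rw [show -(c ^ 2 * t) = c ^ 2 * (-t) by ring, Real.log_mul (by positivity) hnt.ne',
      Real.log_pow]
    push_cast
    ring
  have hlogc : Real.log c = -θ / (2 * α) := by rw [hc, Real.log_exp]
  have hangle : α * -Real.log (-(c ^ 2 * t)) = θ + α * -Real.log (-t) := by
    rw [hlog, hlogc]
    field_simp
    ring
  -- left-hand side in normal form
  have eL : nsRescale c (pvAnsatz α (fun y _ => U y)) t x =
      (Real.sqrt (-t))⁻¹ • rotZ (θ + α * -Real.log (-t))
        (U (rotZ (-(θ + α * -Real.log (-t))) ((Real.sqrt (-t))⁻¹ • x))) := by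
    rw [nsRescale_apply]
    simp only [pvAnsatz]
    rw [hsqrt, hangle, smul_smul, smul_smul]
    congr 1
    · field_simp
    · congr 2
      congr 1
      field_simp
  -- right-hand side in normal form
  have eR : conjZ θ (pvAnsatz α (fun y _ => U y)) t x =
      (Real.sqrt (-t))⁻¹ • rotZ (θ + α * -Real.log (-t))
        (U (rotZ (-(θ + α * -Real.log (-t))) ((Real.sqrt (-t))⁻¹ • x))) := by
    simp only [conjZ, pvAnsatz]
    rw [rotZ_smul', ← rotZ_add, rotZ_smul', ← rotZ_add,
      show -(α * -Real.log (-t)) + -θ = -(θ + α * -Real.log (-t)) by ring,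
      ← rotZ_smul' (-(θ + α * -Real.log (-t))) (Real.sqrt (-t))⁻¹ x]
  rw [eL, eR]

/-! ### The spiral world: a literature-consistent scenario in which the crux fails -/

/-- **Conditional refutation (spiral world).**  Suppose (i) some singular apex profile exists and
(ii) for one fixed `α ≠ 0`, EVERY singular apex profile (any constant) is `α`-RSS with a
non-axisymmetric scar.  Then `SymmetricScarExists` is false: a homogeneous-scar witness would be
RSS, hence axisymmetric-scarred (`homScar_iff_axiScar_of_isSpiralRSS`).  Hypothesis (ii) describes
the symmetry orbit of a single RSS Type-I profile with `α ≈ 1` and a non-`SO(2)`-equivariant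
far-field pattern `A₀` (scar `|x|⁻¹ R_{−2α log|x|} A₀(R_{2α log|x|} x̂)`); no Liouville theorem in
print excludes it (P–V 2026 p. 3: open; Conj. 1.1), and `ScarRigidity` is consistent with it
(distinct conjugates have distinct scars).  Hence every proof of the crux proves, in particular,
that this world is empty — a Perelman-type Liouville theorem for non-equivariant patterns.
[cite: PineauVicol2026, Conjecture 1.1 and Theorem 1.4 (arXiv:2607.09619 pp. 3–4)] -/
theorem not_symmetricScarExists_of_spiral_world {α : ℝ} (hα : α ≠ 0)
    (hex : ∃ (C : ℝ) (u : ℝ → (EuclideanSpace ℝ (Fin 3)) → (EuclideanSpace ℝ (Fin 3))) (p : ℝ → (EuclideanSpace ℝ (Fin 3)) → ℝ) (G : ℝ → (EuclideanSpace ℝ (Fin 3)) → (EuclideanSpace ℝ (Fin 3)) →L[ℝ] (EuclideanSpace ℝ (Fin 3))),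
      IsSuitableWeakSolutionOn (slab (EuclideanSpace ℝ (Fin 3)) (Iio (0 : ℝ)) isOpen_Iio) 1 0 u p ∧ HasWeakSpatialGradientOn (slab (EuclideanSpace ℝ (Fin 3)) (Iio (0 : ℝ)) isOpen_Iio) u G ∧
      typeIBound (Iio (0 : ℝ) ×ˢ univ) u p G < ⊤ ∧ HasTypeIDecay C u ∧
      IsBackwardSingularPoint u 0)
    (hworld : ∀ (C : ℝ) (u : ℝ → (EuclideanSpace ℝ (Fin 3)) → (EuclideanSpace ℝ (Fin 3))) (p : ℝ → (EuclideanSpace ℝ (Fin 3)) → ℝ) (G : ℝ → (EuclideanSpace ℝ (Fin 3)) → (EuclideanSpace ℝ (Fin 3)) →L[ℝ] (EuclideanSpace ℝ (Fin 3))),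
      IsSuitableWeakSolutionOn (slab (EuclideanSpace ℝ (Fin 3)) (Iio (0 : ℝ)) isOpen_Iio) 1 0 u p → HasWeakSpatialGradientOn (slab (EuclideanSpace ℝ (Fin 3)) (Iio (0 : ℝ)) isOpen_Iio) u G →
      typeIBound (Iio (0 : ℝ) ×ˢ univ) u p G < ⊤ → HasTypeIDecay C u →
      IsBackwardSingularPoint u 0 → IsSpiralRSS α u ∧ ¬ AxiScar u) :
    ¬ SymmetricScarExists := by
  intro hS
  obtain ⟨C, u, p, G, hsw, hwg, hI, hdec, hsing⟩ := hex
  obtain ⟨C', v, q, H, hsw', hwg', hI', hdec', hsing', hsym⟩ :=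
    hS C ⟨u, p, G, hsw, hwg, hI, hdec, hsing⟩
  obtain ⟨hRSS, hnotAxi⟩ := hworld C' v q H hsw' hwg' hI' hdec' hsing'
  rcases hsym with hHom | hAxi
  · exact hnotAxi ((homScar_iff_axiScar_of_isSpiralRSS hα hRSS).1 hHom)
  · exact hnotAxi hAxi

/-! ### The repaired crux for the planner -/

/-- **Repaired crux `S⁺`** (planner-facing): the selection a symmetry engine on the compact set of
singular apex profiles modulo `ℝ₊ × SO(2)` can at best deliver — a profile whose scar is fixed by
SOME one-parameter subgroup: a spiral one (`∃ α, SpiralScar α u`; `α = 0` is the homogeneous case)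
or the rotations (`AxiScar u`).  Closing the route with `S⁺` needs a third Fatal support,
"spiral-scar singular apex profiles do not exist", which under `ScarRigidity` is Perelman's
Conjecture (P–V Conj. 1.1, open for `α ≈ 1`). -/
def SymmetricScarExistsSpiral : Prop :=
  ∀ C : ℝ, (∃ (u : ℝ → (EuclideanSpace ℝ (Fin 3)) → (EuclideanSpace ℝ (Fin 3))) (p : ℝ → (EuclideanSpace ℝ (Fin 3)) → ℝ) (G : ℝ → (EuclideanSpace ℝ (Fin 3)) → (EuclideanSpace ℝ (Fin 3)) →L[ℝ] (EuclideanSpace ℝ (Fin 3))),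
      IsSuitableWeakSolutionOn (slab (EuclideanSpace ℝ (Fin 3)) (Iio (0 : ℝ)) isOpen_Iio) 1 0 u p ∧ HasWeakSpatialGradientOn (slab (EuclideanSpace ℝ (Fin 3)) (Iio (0 : ℝ)) isOpen_Iio) u G ∧
      typeIBound (Iio (0 : ℝ) ×ˢ univ) u p G < ⊤ ∧ HasTypeIDecay C u ∧
      IsBackwardSingularPoint u 0) →
    ∃ (C' : ℝ) (u : ℝ → (EuclideanSpace ℝ (Fin 3)) → (EuclideanSpace ℝ (Fin 3))) (p : ℝ → (EuclideanSpace ℝ (Fin 3)) → ℝ) (G : ℝ → (EuclideanSpace ℝ (Fin 3)) → (EuclideanSpace ℝ (Fin 3)) →L[ℝ] (EuclideanSpace ℝ (Fin 3))),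
      IsSuitableWeakSolutionOn (slab (EuclideanSpace ℝ (Fin 3)) (Iio (0 : ℝ)) isOpen_Iio) 1 0 u p ∧ HasWeakSpatialGradientOn (slab (EuclideanSpace ℝ (Fin 3)) (Iio (0 : ℝ)) isOpen_Iio) u G ∧
      typeIBound (Iio (0 : ℝ) ×ˢ univ) u p G < ⊤ ∧ HasTypeIDecay C' u ∧
      IsBackwardSingularPoint u 0 ∧ ((∃ α : ℝ, SpiralScar α u) ∨ AxiScar u)

/-- The crux implies its repaired form (`HomScar = SpiralScar 0`). [folklore] -/
theorem symmetricScarExistsSpiral_of_symmetricScarExists (hS : SymmetricScarExists) :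
    SymmetricScarExistsSpiral := by
  intro C hex
  obtain ⟨C', v, q, H, hsw', hwg', hI', hdec', hsing', hsym⟩ := hS C hex
  refine ⟨C', v, q, H, hsw', hwg', hI', hdec', hsing', ?_⟩
  rcases hsym with hHom | hAxi
  · exact Or.inl ⟨0, spiralScar_zero_iff.2 hHom⟩
  · exact Or.inr hAxi

/-- **In the spiral world the repaired crux holds while the crux fails**: the RSS profile itself
is a spiral-scar witness (`spiralScar_of_isSpiralRSS`).  So the crux is STRICTLY stronger than what
the card's own engines (monotone / extremal selection modulo symmetries) aim at. [cite: PineauVicol2026, §1.2] -/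
theorem symmetricScarExistsSpiral_of_spiral_world {α : ℝ} (hα : α ≠ 0)
    (hworld : ∀ (C : ℝ) (u : ℝ → (EuclideanSpace ℝ (Fin 3)) → (EuclideanSpace ℝ (Fin 3))) (p : ℝ → (EuclideanSpace ℝ (Fin 3)) → ℝ) (G : ℝ → (EuclideanSpace ℝ (Fin 3)) → (EuclideanSpace ℝ (Fin 3)) →L[ℝ] (EuclideanSpace ℝ (Fin 3))),
      IsSuitableWeakSolutionOn (slab (EuclideanSpace ℝ (Fin 3)) (Iio (0 : ℝ)) isOpen_Iio) 1 0 u p → HasWeakSpatialGradientOn (slab (EuclideanSpace ℝ (Fin 3)) (Iio (0 : ℝ)) isOpen_Iio) u G →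
      typeIBound (Iio (0 : ℝ) ×ˢ univ) u p G < ⊤ → HasTypeIDecay C u →
      IsBackwardSingularPoint u 0 → IsSpiralRSS α u) :
    SymmetricScarExistsSpiral := by
  intro C hex
  obtain ⟨u, p, G, hsw, hwg, hI, hdec, hsing⟩ := hex
  exact ⟨C, u, p, G, hsw, hwg, hI, hdec, hsing,
    Or.inl ⟨α, spiralScar_of_isSpiralRSS hα (hworld C u p G hsw hwg hI hdec hsing)⟩⟩

end Spiral

end Summit.NavierStokesRegularity.NavierStokesRegularity.Theorems.SymmetricScarExists.Negative
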